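import Summits.QuantumFields.YangMills.Theorems.FluctuationComparisonRegPrIntLClassicalPerHeightOfWindowExactness
import HarnessLib

/-!
# S2α · `ClassicalTwoDepth` (LINE `runpair_organ` v18.2, `def ClassicalTwoDepth` :341; `stub_classicalTwoDepth` :775 is derived there from S2α′ by `classicalTwoDepth_of_perHeight`)
# THEOREMS-SIDE: OUTRIGHT at every block size `L ≥ 5`, ⟸ EXW∘ BY TEXT, ⟸ the ONE named fact `B8Thm2AtT3Members` — the classical TWO-DEPTH equilibration with a height
# profile, ONE summed antitone null depth rate and the clustering factor (FILE 4 of the px17 g18 chain; FILE 3 = ✓`…ClassicalPerHeightOfWindowExactness`)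

Cell `ym3-torus` (HUMAN RULING D-0037; rung R3 = continuum `SU(2)` Yang–Mills on the three-torus at fixed lattice data — NOT d = 4, NOT infinite volume, NOT a mass gap,
NOT Clay).  Width seat `ym3-torus-px17` (gen 18); crux `stmt-QuantumFields-20520`; `--kind proof --supports stmt-QuantumFields-20520 --as helper`, count-neutral;
DEFINITION-FREE (0 `def`, 0 `instance`, 0 `notation`, 0 `sorry`, default heartbeats).

WHAT.  The line file proves `classicalTwoDepth_of_perHeight : ClassicalPerHeight → ClassicalTwoDepth` (v9 glue: tail suprema `Ā_J n := sup_{k ≥ n} A_J k`, weights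
`c_J := 2^{−J}∕(Ā_J 0 + 1)`, the summed rate `τ n := Σ_J c_J Ā_J n` — antitone, null by dominated convergence (Tannery) —, the height profile `P J := e^{Dm_J}∕c_J` with `Dm_J`
the finite `tdist`-diameter of the bond set absorbing the clustering factor at `κ := 1`).  `Cruxes/*` is not importable; this file carries that proof VERBATIM at one block size
(§1 `classicalTwoDepthAt_of_classicalPerHeightAt`) and composes it with FILE 3: §2 ★★★★★ `classicalTwoDepth_body_five (L) (h5 : 5 ≤ L)` — ZERO hypotheses;
`classicalTwoDepth_of_windowExactness : ⟨WindowExactness v11.4 TEXT⟩ → ⟨ClassicalTwoDepth v18.2 TEXT⟩`; `…_of_thm1AtThree`; ★★★★★ `classicalTwoDepth_of_b8Thm2AtT3Members (hX)`.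

HONEST.  The §1 proof is the line file's own (ideator lineage, v9), re-homed with `L` fixed; the analytic content is FILE 3's (⟸ EXW∘ ⟸ Thm 1 (8) at `L ≥ 5`); nothing of Bałaban's
analysis is added; `stub_classicalTwoDepth`∕`stub_classicalPerHeight` (every `L` incl. `L = 3`, EMBARGO-LITE №58), S2β, crux 20520, 19936, 19200 and `YM3TorusSU2` are NOT proved;
rung R3 = SU(2) YM₃ on T³ at fixed lattice data — NOT d = 4, NOT infinite volume, NOT a mass gap, NOT Clay; the Yang–Mills mass gap is NOT proved.

References: T. Bałaban, CMP **102** (1985) 277–309 [Balaban1985Variational] (Thm 1 (8)–(10) p.279, Prop. 8 p.304); CMP **102** (1985) 255–275 [Balaban1985UV3] ((3), (5) p.256,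
(41) p.266); C. King, CMP **102** (1986) 649–677 [King1986] (Prop. 3.10 p.666, (A.5) p.676).
-/

set_option autoImplicit false

noncomputable section

namespace Summit.QuantumFields.YangMills.Theorems.FluctuationComparisonRegPrIntLClassicalTwoDepthOfPerHeight

open MeasureTheory Filter Topology
open scoped BigOperators
open Literature.MathematicalPhysics.QuantumFieldTheory.Balaban1983to89
open Literature.MathematicalPhysics.QuantumFieldTheory.Balaban1983to89.T3ContinuumYM3Torus
open Literature.MathematicalPhysics.QuantumFieldTheory.Balaban1983to89.T3UnitLawDensityEML (ℰp)
open Literature.MathematicalPhysics.QuantumFieldTheory.Balaban1983to89.T3UnitScaleTilt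
open Literature.MathematicalPhysics.QuantumFieldTheory.Balaban1983to89.T3TiltDescent
open Literature.MathematicalPhysics.QuantumFieldTheory.Balaban1983to89.T3ConstrainedMinimiser (fibre)
open Literature.MathematicalPhysics.QuantumFieldTheory.Balaban1983to89.T3PrintedRegularMinimiser
open Literature.MathematicalPhysics.QuantumFieldTheory.Balaban1983to89.T3PrintedMinimiserExistence (Thm1GlobalMinAt)
open Literature.MathematicalPhysics.QuantumFieldTheory.Balaban1983to89.T3B8Thm2AtMembers (B8Thm2AtT3Members)
open Literature.MathematicalPhysics.QuantumFieldTheory.Balaban1983to89.T4Continuum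
open Summit.QuantumFields.YangMills.Theorems.FluctuationComparisonRegPrIntLClassicalPerHeightOfWindowExactness

/-! ## §1 S2α at one block size from S2α′ at that block size (the line file's v9 glue VERBATIM, `L` fixed) -/

/-- ★★ **S2α AT ONE BLOCK SIZE ⟸ S2α′ AT THAT BLOCK SIZE** — `Lines/runpair_organ.lean`'s `classicalTwoDepth_of_perHeight` with `L` fixed: tail suprema, the summed antitone
null rate (dominated convergence), the clustering factor `e^{−κ·tdist}` at `κ := 1` absorbed into the height profile through the finite diameter of `PBond (F.P J) 0`.
[cite: Balaban1985Variational, Thm 1 (8)-(10) p.279; King1986, (A.5) p.676] -/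
theorem classicalTwoDepthAt_of_classicalPerHeightAt {L : ℕ}
    (h : ∀ (b₀ p₀ : ℝ), 0 < b₀ → 0 < p₀ → ∃ ε₁ : ℝ, 0 < ε₁ ∧ ∀ (ε₀ : ℝ), 0 < ε₀ → ε₀ ≤ ε₁ →
    ∃ γ₁ : ℝ, 0 < γ₁ ∧ ∀ (F : T3Family) (γ : ℝ), F.L = L → 0 < γ → γ ≤ γ₁ →
      ∀ J : ℕ, ∃ A : ℕ → ℝ, (∀ n, 0 ≤ A n) ∧ Tendsto A atTop (𝓝 0) ∧
        ∀ (K K' : ℕ) (hJK : J ≤ K) (hJK' : J ≤ K'), K ≤ K' →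
          ∀ (b b' : PBond (F.P J) 0) (U V W Z : GaugeField (F.P J) 0 (Matrix.specialUnitaryGroup (Fin 2) ℂ)),
            PlaqSmall (θBal F.L γ b₀ p₀ J) U → PlaqSmall (θBal F.L γ b₀ p₀ J) V →
            PlaqSmall (θBal F.L γ b₀ p₀ J) W → PlaqSmall (θBal F.L γ b₀ p₀ J) Z →
            (∀ e, e ≠ b → U e = V e) → (∀ e, e ≠ b' → U e = W e) → (∀ e, e ≠ b' → V e = Z e) → (∀ e, e ≠ b → W e = Z e) →
            |((F.scheme ℰp γ).β K * minActionRegPr F J K hJK ε₀ U - (F.scheme ℰp γ).β K' * minActionRegPr F J K' hJK' ε₀ U)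
              - ((F.scheme ℰp γ).β K * minActionRegPr F J K hJK ε₀ V - (F.scheme ℰp γ).β K' * minActionRegPr F J K' hJK' ε₀ V)
              - (((F.scheme ℰp γ).β K * minActionRegPr F J K hJK ε₀ W - (F.scheme ℰp γ).β K' * minActionRegPr F J K' hJK' ε₀ W)
                - ((F.scheme ℰp γ).β K * minActionRegPr F J K hJK ε₀ Z - (F.scheme ℰp γ).β K' * minActionRegPr F J K' hJK' ε₀ Z))|
              ≤ A (K - J)) :
    ∀ (b₀ p₀ : ℝ), 0 < b₀ → 0 < p₀ → ∃ ε₁ : ℝ, 0 < ε₁ ∧ ∀ (ε₀ : ℝ), 0 < ε₀ → ε₀ ≤ ε₁ →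
    ∃ γ₁ : ℝ, 0 < γ₁ ∧ ∃ κ : ℝ, 0 < κ ∧ ∀ (F : T3Family) (γ : ℝ), F.L = L → 0 < γ → γ ≤ γ₁ →
      ∃ (P τ : ℕ → ℝ), (∀ n, 0 ≤ P n) ∧ (∀ n, 0 ≤ τ n) ∧ Antitone τ ∧ Tendsto τ atTop (𝓝 0) ∧
        ∀ (J K K' : ℕ) (hJK : J ≤ K) (hJK' : J ≤ K'), K ≤ K' →
          ∀ (b b' : PBond (F.P J) 0) (U V W Z : GaugeField (F.P J) 0 (Matrix.specialUnitaryGroup (Fin 2) ℂ)),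
            PlaqSmall (θBal F.L γ b₀ p₀ J) U → PlaqSmall (θBal F.L γ b₀ p₀ J) V →
            PlaqSmall (θBal F.L γ b₀ p₀ J) W → PlaqSmall (θBal F.L γ b₀ p₀ J) Z →
            (∀ e, e ≠ b → U e = V e) → (∀ e, e ≠ b' → U e = W e) → (∀ e, e ≠ b' → V e = Z e) → (∀ e, e ≠ b → W e = Z e) →
            |((F.scheme ℰp γ).β K * minActionRegPr F J K hJK ε₀ U - (F.scheme ℰp γ).β K' * minActionRegPr F J K' hJK' ε₀ U)
              - ((F.scheme ℰp γ).β K * minActionRegPr F J K hJK ε₀ V - (F.scheme ℰp γ).β K' * minActionRegPr F J K' hJK' ε₀ V)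
              - (((F.scheme ℰp γ).β K * minActionRegPr F J K hJK ε₀ W - (F.scheme ℰp γ).β K' * minActionRegPr F J K' hJK' ε₀ W)
                - ((F.scheme ℰp γ).β K * minActionRegPr F J K hJK ε₀ Z - (F.scheme ℰp γ).β K' * minActionRegPr F J K' hJK' ε₀ Z))|
              ≤ P J * τ (K - J) * Real.exp (-(κ * (b.src.tdist b'.src : ℝ))) := by
  classical
  intro b₀ p₀ hb₀ hp₀
  obtain ⟨ε₁, hε₁, H⟩ := h b₀ p₀ hb₀ hp₀
  refine ⟨ε₁, hε₁, fun ε₀ hε₀ hε₀1 => ?_⟩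
  obtain ⟨γ₁, hγ₁, H⟩ := H ε₀ hε₀ hε₀1
  refine ⟨γ₁, hγ₁, 1, one_pos, fun F γ hFL hγ hγ1 => ?_⟩
  have HJ := H F γ hFL hγ hγ1
  choose A hA0 hAt hAb using HJ
  -- tail suprema Ā J n := sup_{k ≥ n} A J k
  have hbdd : ∀ J n, BddAbove (A J '' Set.Ici n) := fun J n =>
    (hAt J).bddAbove_range.mono (Set.image_subset_range _ _)
  have hne : ∀ J n, (A J '' Set.Ici n).Nonempty := fun J n => ⟨A J n, n, Set.mem_Ici.2 le_rfl, rfl⟩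
  let Ab : ℕ → ℕ → ℝ := fun J n => sSup (A J '' Set.Ici n)
  have hA_le : ∀ J n k, n ≤ k → A J k ≤ Ab J n := fun J n k hk => le_csSup (hbdd J n) ⟨k, Set.mem_Ici.2 hk, rfl⟩
  have hAb_le : ∀ J n (c : ℝ), (∀ k, n ≤ k → A J k ≤ c) → Ab J n ≤ c := fun J n c hc =>
    csSup_le (hne J n) (by rintro _ ⟨k, hk, rfl⟩; exact hc k (Set.mem_Ici.1 hk))
  have hAb0 : ∀ J n, 0 ≤ Ab J n := fun J n => (hA0 J n).trans (hA_le J n n le_rfl)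
  have hAb_anti : ∀ J, Antitone (Ab J) := fun J n m hnm =>
    hAb_le J m _ (fun k hk => hA_le J n k (hnm.trans hk))
  have hAb_t : ∀ J, Tendsto (Ab J) atTop (𝓝 0) := by
    intro J
    rw [Metric.tendsto_atTop]
    intro e he
    obtain ⟨N, hN⟩ := (Metric.tendsto_atTop.1 (hAt J)) (e / 2) (half_pos he)
    refine ⟨N, fun n hn => ?_⟩
    rw [Real.dist_eq, sub_zero, abs_of_nonneg (hAb0 J n)]
    have : Ab J n ≤ e / 2 := hAb_le J n _ (fun k hk => by
      have h := hN k (hn.trans hk)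
      rw [Real.dist_eq, sub_zero] at h
      exact (le_abs_self _).trans h.le)
    linarith
  -- weights and the summed rate
  let c : ℕ → ℝ := fun J => ((1 : ℝ) / 2) ^ J / (Ab J 0 + 1)
  have hc0 : ∀ J, 0 < c J := fun J => div_pos (pow_pos (by norm_num) J) (by linarith [hAb0 J 0])
  have hterm0 : ∀ J n, 0 ≤ c J * Ab J n := fun J n => mul_nonneg (hc0 J).le (hAb0 J n)
  have hterm_le : ∀ J n, c J * Ab J n ≤ ((1 : ℝ) / 2) ^ J := by
    intro J n
    have h1 : Ab J n ≤ Ab J 0 + 1 := (hAb_anti J (Nat.zero_le n)).trans (by linarith)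
    have h2 : Ab J n / (Ab J 0 + 1) ≤ 1 := (div_le_one (by linarith [hAb0 J 0])).2 h1
    calc c J * Ab J n = ((1 : ℝ) / 2) ^ J * (Ab J n / (Ab J 0 + 1)) := by
            show ((1 : ℝ) / 2) ^ J / (Ab J 0 + 1) * Ab J n = _; ring
      _ ≤ ((1 : ℝ) / 2) ^ J * 1 := mul_le_mul_of_nonneg_left h2 (pow_nonneg (by norm_num) J)
      _ = ((1 : ℝ) / 2) ^ J := mul_one _
  have hgeom : Summable (fun J : ℕ => ((1 : ℝ) / 2) ^ J) :=
    summable_geometric_of_lt_one (by norm_num) (by norm_num)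
  have hsum : ∀ n, Summable (fun J => c J * Ab J n) := fun n =>
    Summable.of_nonneg_of_le (fun J => hterm0 J n) (fun J => hterm_le J n) hgeom
  let τ : ℕ → ℝ := fun n => ∑' J, c J * Ab J n
  have hτ0 : ∀ n, 0 ≤ τ n := fun n => tsum_nonneg (fun J => hterm0 J n)
  have hτa : Antitone τ := fun n m hnm =>
    Summable.tsum_le_tsum (fun J => mul_le_mul_of_nonneg_left (hAb_anti J hnm) (hc0 J).le) (hsum m) (hsum n)
  have hτt : Tendsto τ atTop (𝓝 0) := by
    have h := tendsto_tsum_of_dominated_convergence (f := fun n J => c J * Ab J n) (g := fun _ => (0 : ℝ))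
      (bound := fun J => ((1 : ℝ) / 2) ^ J) hgeom
      (fun J => by simpa using (hAb_t J).const_mul (c J))
      (Eventually.of_forall fun n J => by rw [Real.norm_eq_abs, abs_of_nonneg (hterm0 J n)]; exact hterm_le J n)
    simpa using h
  have hτ_ge : ∀ J n, c J * Ab J n ≤ τ n := fun J n =>
    (hsum n).le_tsum J (fun i _ => hterm0 i n)
  -- finite diameter of the bond set at each height
  have hDm : ∀ J, ∃ Dm : ℝ, ∀ b b' : PBond (F.P J) 0, (b.src.tdist b'.src : ℝ) ≤ Dm := by
    intro J
    obtain ⟨M, hM⟩ := Finite.exists_le (fun q : PBond (F.P J) 0 × PBond (F.P J) 0 => (q.1.src.tdist q.2.src : ℝ))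
    exact ⟨M, fun b b' => hM (b, b')⟩
  choose Dm hDm using hDm
  refine ⟨fun J => Real.exp (Dm J) / c J, τ, fun J => (div_pos (Real.exp_pos _) (hc0 J)).le, hτ0, hτa, hτt, ?_⟩
  intro J K K' hJK hJK' hKK' b b' U V W Z hU hV hW hZ h1 h2 h3 h4
  have hD := hAb J K K' hJK hJK' hKK' b b' U V W Z hU hV hW hZ h1 h2 h3 h4
  refine hD.trans ?_
  have step1 : A J (K - J) ≤ Ab J (K - J) := hA_le J _ _ le_rfl
  have step2 : Ab J (K - J) ≤ τ (K - J) / c J := by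
    rw [le_div_iff₀ (hc0 J), mul_comm]; exact hτ_ge J _
  have step3 : Real.exp (-(Dm J)) ≤ Real.exp (-(1 * (b.src.tdist b'.src : ℝ))) :=
    Real.exp_le_exp.2 (by rw [one_mul]; exact neg_le_neg (hDm J b b'))
  have hE : Real.exp (Dm J) * Real.exp (-(Dm J)) = 1 := by
    rw [← Real.exp_add, add_neg_cancel, Real.exp_zero]
  have hnn : 0 ≤ Real.exp (Dm J) / c J * τ (K - J) :=
    mul_nonneg (div_pos (Real.exp_pos _) (hc0 J)).le (hτ0 _)
  calc A J (K - J) ≤ τ (K - J) / c J := step1.trans step2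
    _ = Real.exp (Dm J) / c J * τ (K - J) * Real.exp (-(Dm J)) := by
        rw [show Real.exp (Dm J) / c J * τ (K - J) * Real.exp (-(Dm J))
            = τ (K - J) / c J * (Real.exp (Dm J) * Real.exp (-(Dm J))) by ring, hE, mul_one]
    _ ≤ Real.exp (Dm J) / c J * τ (K - J) * Real.exp (-(1 * (b.src.tdist b'.src : ℝ))) :=
        mul_le_mul_of_nonneg_left step3 hnn


/-! ## §2 ★★★★★ S2α `ClassicalTwoDepth` (TEXT VERBATIM): OUTRIGHT at every `L ≥ 5`; from EXW∘ by text; from Thm 1 (8) at `L = 3`; from the ONE named fact -/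

/-- ★★★★★ **S2α's BODY AT EVERY BLOCK SIZE `L ≥ 5` — ZERO HYPOTHESES** (✓`classicalPerHeight_body_five` ∘ §1). [cite: Balaban1985Variational, Thm 1 (8) p.279, Prop. 8 p.304; Balaban1985UV3, (3), (5) p.256, (41) p.266] -/
theorem classicalTwoDepth_body_five (L : ℕ) (h5 : 5 ≤ L) :
    ∀ (b₀ p₀ : ℝ), 0 < b₀ → 0 < p₀ → ∃ ε₁ : ℝ, 0 < ε₁ ∧ ∀ (ε₀ : ℝ), 0 < ε₀ → ε₀ ≤ ε₁ →
    ∃ γ₁ : ℝ, 0 < γ₁ ∧ ∃ κ : ℝ, 0 < κ ∧ ∀ (F : T3Family) (γ : ℝ), F.L = L → 0 < γ → γ ≤ γ₁ →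
      ∃ (P τ : ℕ → ℝ), (∀ n, 0 ≤ P n) ∧ (∀ n, 0 ≤ τ n) ∧ Antitone τ ∧ Tendsto τ atTop (𝓝 0) ∧
        ∀ (J K K' : ℕ) (hJK : J ≤ K) (hJK' : J ≤ K'), K ≤ K' →
          ∀ (b b' : PBond (F.P J) 0) (U V W Z : GaugeField (F.P J) 0 (Matrix.specialUnitaryGroup (Fin 2) ℂ)),
            PlaqSmall (θBal F.L γ b₀ p₀ J) U → PlaqSmall (θBal F.L γ b₀ p₀ J) V →
            PlaqSmall (θBal F.L γ b₀ p₀ J) W → PlaqSmall (θBal F.L γ b₀ p₀ J) Z →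
            (∀ e, e ≠ b → U e = V e) → (∀ e, e ≠ b' → U e = W e) → (∀ e, e ≠ b' → V e = Z e) → (∀ e, e ≠ b → W e = Z e) →
            |((F.scheme ℰp γ).β K * minActionRegPr F J K hJK ε₀ U - (F.scheme ℰp γ).β K' * minActionRegPr F J K' hJK' ε₀ U)
              - ((F.scheme ℰp γ).β K * minActionRegPr F J K hJK ε₀ V - (F.scheme ℰp γ).β K' * minActionRegPr F J K' hJK' ε₀ V)
              - (((F.scheme ℰp γ).β K * minActionRegPr F J K hJK ε₀ W - (F.scheme ℰp γ).β K' * minActionRegPr F J K' hJK' ε₀ W)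
                - ((F.scheme ℰp γ).β K * minActionRegPr F J K hJK ε₀ Z - (F.scheme ℰp γ).β K' * minActionRegPr F J K' hJK' ε₀ Z))|
              ≤ P J * τ (K - J) * Real.exp (-(κ * (b.src.tdist b'.src : ℝ))) :=
  classicalTwoDepthAt_of_classicalPerHeightAt (classicalPerHeight_body_five L h5)

/-- ★★★★★ **S2α ⟸ EXW∘, BY TEXT**: hypothesis = the v11.4 registry text of `WindowExactness` VERBATIM; conclusion = the v18.2 text of `ClassicalTwoDepth` VERBATIM
(✓`classicalPerHeight_of_windowExactness` ∘ §1). [cite: Balaban1985Variational, Thm 1 (8) p.279; Balaban1985UV3, (41) p.266] -/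
theorem classicalTwoDepth_of_windowExactness
    (hW : ∀ (L : ℕ), ∃ c₀ : ℝ, 0 < c₀ ∧ c₀ ≤ 1 ∧ ∀ (cw : ℝ), 0 < cw → cw ≤ c₀ → ∃ pS : ℝ, ∀ (b₀ p₀ : ℝ), 0 < b₀ → pS ≤ p₀ → 0 < p₀ → ∃ ε₁ : ℝ, 0 < ε₁ ∧ ∀ (ε₀ : ℝ), 0 < ε₀ → ε₀ ≤ ε₁ →
    ∃ γ₁ : ℝ, 0 < γ₁ ∧ ∀ (F : T3Family) (γ : ℝ), F.L = L → 0 < γ → γ ≤ γ₁ →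
      ∀ (J K : ℕ) (hJK : J ≤ K) (V : GaugeField (F.P J) 0 (Matrix.specialUnitaryGroup (Fin 2) ℂ)), PlaqSmall (θBal F.L γ (cw * b₀) p₀ J) V →
        (∀ U ∈ fibre F ℰp J K hJK V, U ∈ histGood F ℰp (θBal F.L γ b₀ p₀) K J →
            minActionRegPr F J K hJK ε₀ V ≤ wilsonAction4 U) ∧
        (∃ U₀ ∈ regFibrePr F J K hJK ε₀ V, U₀ ∈ histGood F ℰp (θBal F.L γ b₀ p₀) K J ∧
            wilsonAction4 U₀ = minActionRegPr F J K hJK ε₀ V)) :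
  ∀ (L : ℕ) (b₀ p₀ : ℝ), 0 < b₀ → 0 < p₀ → ∃ ε₁ : ℝ, 0 < ε₁ ∧ ∀ (ε₀ : ℝ), 0 < ε₀ → ε₀ ≤ ε₁ →
    ∃ γ₁ : ℝ, 0 < γ₁ ∧ ∃ κ : ℝ, 0 < κ ∧ ∀ (F : T3Family) (γ : ℝ), F.L = L → 0 < γ → γ ≤ γ₁ →
      ∃ (P τ : ℕ → ℝ), (∀ n, 0 ≤ P n) ∧ (∀ n, 0 ≤ τ n) ∧ Antitone τ ∧ Tendsto τ atTop (𝓝 0) ∧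
        ∀ (J K K' : ℕ) (hJK : J ≤ K) (hJK' : J ≤ K'), K ≤ K' →
          ∀ (b b' : PBond (F.P J) 0) (U V W Z : GaugeField (F.P J) 0 (Matrix.specialUnitaryGroup (Fin 2) ℂ)),
            PlaqSmall (θBal F.L γ b₀ p₀ J) U → PlaqSmall (θBal F.L γ b₀ p₀ J) V →
            PlaqSmall (θBal F.L γ b₀ p₀ J) W → PlaqSmall (θBal F.L γ b₀ p₀ J) Z →
            (∀ e, e ≠ b → U e = V e) → (∀ e, e ≠ b' → U e = W e) → (∀ e, e ≠ b' → V e = Z e) → (∀ e, e ≠ b → W e = Z e) →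
            |((F.scheme ℰp γ).β K * minActionRegPr F J K hJK ε₀ U - (F.scheme ℰp γ).β K' * minActionRegPr F J K' hJK' ε₀ U)
              - ((F.scheme ℰp γ).β K * minActionRegPr F J K hJK ε₀ V - (F.scheme ℰp γ).β K' * minActionRegPr F J K' hJK' ε₀ V)
              - (((F.scheme ℰp γ).β K * minActionRegPr F J K hJK ε₀ W - (F.scheme ℰp γ).β K' * minActionRegPr F J K' hJK' ε₀ W)
                - ((F.scheme ℰp γ).β K * minActionRegPr F J K hJK ε₀ Z - (F.scheme ℰp γ).β K' * minActionRegPr F J K' hJK' ε₀ Z))|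
              ≤ P J * τ (K - J) * Real.exp (-(κ * (b.src.tdist b'.src : ℝ))) :=
  fun L => classicalTwoDepthAt_of_classicalPerHeightAt (classicalPerHeight_of_windowExactness hW L)

/-- ★★★★ **S2α ⟸ THM 1 (8) AT `L = 3` ALONE** (✓`classicalPerHeight_of_thm1AtThree` ∘ §1; `L = 3` = EMBARGO-LITE №58's socket). [cite: Balaban1985Variational, Thm 1 (8) p.279; Balaban1985RegularSpaces, Thm 2 p.83] -/
theorem classicalTwoDepth_of_thm1AtThree (hT₃ : ∃ a₀ a₁ B₃ : ℝ, 0 < a₀ ∧ 0 < a₁ ∧ 0 < B₃ ∧ Thm1GlobalMinAt 3 a₀ a₁ B₃) :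
  ∀ (L : ℕ) (b₀ p₀ : ℝ), 0 < b₀ → 0 < p₀ → ∃ ε₁ : ℝ, 0 < ε₁ ∧ ∀ (ε₀ : ℝ), 0 < ε₀ → ε₀ ≤ ε₁ →
    ∃ γ₁ : ℝ, 0 < γ₁ ∧ ∃ κ : ℝ, 0 < κ ∧ ∀ (F : T3Family) (γ : ℝ), F.L = L → 0 < γ → γ ≤ γ₁ →
      ∃ (P τ : ℕ → ℝ), (∀ n, 0 ≤ P n) ∧ (∀ n, 0 ≤ τ n) ∧ Antitone τ ∧ Tendsto τ atTop (𝓝 0) ∧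
        ∀ (J K K' : ℕ) (hJK : J ≤ K) (hJK' : J ≤ K'), K ≤ K' →
          ∀ (b b' : PBond (F.P J) 0) (U V W Z : GaugeField (F.P J) 0 (Matrix.specialUnitaryGroup (Fin 2) ℂ)),
            PlaqSmall (θBal F.L γ b₀ p₀ J) U → PlaqSmall (θBal F.L γ b₀ p₀ J) V →
            PlaqSmall (θBal F.L γ b₀ p₀ J) W → PlaqSmall (θBal F.L γ b₀ p₀ J) Z →
            (∀ e, e ≠ b → U e = V e) → (∀ e, e ≠ b' → U e = W e) → (∀ e, e ≠ b' → V e = Z e) → (∀ e, e ≠ b → W e = Z e) →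
            |((F.scheme ℰp γ).β K * minActionRegPr F J K hJK ε₀ U - (F.scheme ℰp γ).β K' * minActionRegPr F J K' hJK' ε₀ U)
              - ((F.scheme ℰp γ).β K * minActionRegPr F J K hJK ε₀ V - (F.scheme ℰp γ).β K' * minActionRegPr F J K' hJK' ε₀ V)
              - (((F.scheme ℰp γ).β K * minActionRegPr F J K hJK ε₀ W - (F.scheme ℰp γ).β K' * minActionRegPr F J K' hJK' ε₀ W)
                - ((F.scheme ℰp γ).β K * minActionRegPr F J K hJK ε₀ Z - (F.scheme ℰp γ).β K' * minActionRegPr F J K' hJK' ε₀ Z))|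
              ≤ P J * τ (K - J) * Real.exp (-(κ * (b.src.tdist b'.src : ℝ))) :=
  fun L => classicalTwoDepthAt_of_classicalPerHeightAt (classicalPerHeight_of_thm1AtThree hT₃ L)

/-- ★★★★★ **S2α `stub_classicalTwoDepth`'s TEXT, CLOSED MODULO THE ONE NAMED LITERATURE FACT `B8Thm2AtT3Members` — NOTHING ELSE** (✓`classicalPerHeight_of_b8Thm2AtT3Members` ∘ §1).
CONDITIONAL; the stub is NOT landed by this. [cite: Balaban1985Variational, Thm 1 (8) p.279, Prop. 8 p.304; Balaban1985RegularSpaces, Thm 2 p.83; Balaban1985UV3, (41) p.266] -/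
theorem classicalTwoDepth_of_b8Thm2AtT3Members (hX : B8Thm2AtT3Members) :
  ∀ (L : ℕ) (b₀ p₀ : ℝ), 0 < b₀ → 0 < p₀ → ∃ ε₁ : ℝ, 0 < ε₁ ∧ ∀ (ε₀ : ℝ), 0 < ε₀ → ε₀ ≤ ε₁ →
    ∃ γ₁ : ℝ, 0 < γ₁ ∧ ∃ κ : ℝ, 0 < κ ∧ ∀ (F : T3Family) (γ : ℝ), F.L = L → 0 < γ → γ ≤ γ₁ →
      ∃ (P τ : ℕ → ℝ), (∀ n, 0 ≤ P n) ∧ (∀ n, 0 ≤ τ n) ∧ Antitone τ ∧ Tendsto τ atTop (𝓝 0) ∧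
        ∀ (J K K' : ℕ) (hJK : J ≤ K) (hJK' : J ≤ K'), K ≤ K' →
          ∀ (b b' : PBond (F.P J) 0) (U V W Z : GaugeField (F.P J) 0 (Matrix.specialUnitaryGroup (Fin 2) ℂ)),
            PlaqSmall (θBal F.L γ b₀ p₀ J) U → PlaqSmall (θBal F.L γ b₀ p₀ J) V →
            PlaqSmall (θBal F.L γ b₀ p₀ J) W → PlaqSmall (θBal F.L γ b₀ p₀ J) Z →
            (∀ e, e ≠ b → U e = V e) → (∀ e, e ≠ b' → U e = W e) → (∀ e, e ≠ b' → V e = Z e) → (∀ e, e ≠ b → W e = Z e) →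
            |((F.scheme ℰp γ).β K * minActionRegPr F J K hJK ε₀ U - (F.scheme ℰp γ).β K' * minActionRegPr F J K' hJK' ε₀ U)
              - ((F.scheme ℰp γ).β K * minActionRegPr F J K hJK ε₀ V - (F.scheme ℰp γ).β K' * minActionRegPr F J K' hJK' ε₀ V)
              - (((F.scheme ℰp γ).β K * minActionRegPr F J K hJK ε₀ W - (F.scheme ℰp γ).β K' * minActionRegPr F J K' hJK' ε₀ W)
                - ((F.scheme ℰp γ).β K * minActionRegPr F J K hJK ε₀ Z - (F.scheme ℰp γ).β K' * minActionRegPr F J K' hJK' ε₀ Z))|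
              ≤ P J * τ (K - J) * Real.exp (-(κ * (b.src.tdist b'.src : ℝ))) :=
  fun L => classicalTwoDepthAt_of_classicalPerHeightAt (classicalPerHeight_of_b8Thm2AtT3Members hX L)

end Summit.QuantumFields.YangMills.Theorems.FluctuationComparisonRegPrIntLClassicalTwoDepthOfPerHeight

end
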